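/-
Origin: expansion seat `planner-pub-hodgecm-pv10-g3-0`, handover #4 2026-08-18T08:56:03Z (`HOME/pub-hodgecm-pv10-g3/lean/Pv10g3/MahlerCriterion.lean`, md5 397ea34d, 424 lines);
landed by the gen-7 packager in gate run 27 as `HodgeCM/PerL34/MahlerCriterion.lean` (import ^import Pv10g3V\.→import HodgeCM.Vendored.H21. ×4).
-/
/-
Copyright (c) 2026. All rights reserved.
Released under Apache 2.0 license as described in the file LICENSE.
-/
import Literature.NumberTheory.Automorphic.MinkowskiReductionGLn
import Literature.NumberTheory.Automorphic.GLnMaximalCompactCompact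
import Literature.NumberTheory.Automorphic.IdeleClassGroupAutomorphicQuotientProofs
import Literature.NumberTheory.Automorphic.AdelicVectorHeightCompact
import Mathlib.Topology.Order.Compact

/-!
# Mahler's compactness criterion for `GL_n` over the adeles of a number field

**Theorem (Mahler's criterion, adelic form; Godement, *Domaines fondamentaux des groupes arithmétiques*,
Sém. Bourbaki 257 (1962/63), § 3 Lemme / Thm 3; Borel, *Introduction aux groupes arithmétiques* (1969),
Prop. 8.4; Platonov–Rapinchuk (1994), Prop. 5.2).**  For every `c > 0` and `b` there is a COMPACT subset
`C ⊆ GL_n(𝔸_K)` such that every `g ∈ GL_n(𝔸_K)` whose rational row vectors are uniformly long,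
`h(ξ g) ≥ c` for all `ξ ∈ Kⁿ ∖ 0` (the global height `h` of the vendored `AdelicVectorHeight`), and whose
determinant is bounded, `|det g|_𝔸 ≤ b`, lies in `GL_n(K) · C` (`exists_isCompact_rational_mul`); dually
(transpose) for column vectors with `C · GL_n(K)` (`exists_isCompact_mul_rational`).

The proof is read off the vendored KERNEL Minkowski reduction `exists_minkowskiReduction`
(`g = γ · u · diag(m) · k`, `t |mᵢ₊₁| ≤ |mᵢ|`): the last Minkowski vector `e_n γ⁻¹` has `h(e_n γ⁻¹ · g) = |m_n|`,
so `|m_n| ≥ c`; the root inequalities give `|mᵢ| ≥ tⁿ c`; `∏ |mᵢ| · |det k| = |det g| ≤ b` with `|det k|`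
bounded below on the compact `K` bounds each `|mᵢ|` above; hence the positive-real parts of the `mᵢ` live in
a compact box, and the bookkeeping of the vendored `reductionTheory_gl_of_minkowskiReduction`
(`N(𝔸) = N(K)·C_N`, `M(𝔸)¹ = M(K)·C_M`) finishes.  Everything here is kernel-checked from Mathlib and the
vendored (placeholder-free, Mathlib-only) harness files; no named fact is consumed.

Main results (namespace `HodgeCM.PerL34.Mahler`):
* `glTranspose`, `continuous_glTranspose` — transpose on `GL_n(R)`;
* `continuous_det`, `exists_pos_le_ideleNorm_det` — `|det k|_𝔸 ≥ κ > 0` on `K`;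
* `vecHeight_lastMinkowskiRow` — `h(e_n γ⁻¹ · γ u diag(m) k) = |m_n|_𝔸`;
* `exists_isCompact_rational_mul` — **Mahler's criterion** (rows, `GL_n(K)` on the left);
* `exists_isCompact_mul_rational` — the column / right version.
-/

set_option autoImplicit false

noncomputable section

open scoped NNReal MatrixGroups Matrix Pointwise
open NumberField IsDedekindDomain

namespace HodgeCM.PerL34.Mahler

open Literature.NumberTheory Literature.NumberTheory.Automorphic

/-! ## § 0. Transpose and determinant on `GL_n(R)` -/

section General

variable {ι : Type*} [Fintype ι] [DecidableEq ι] {R : Type*} [CommRing R]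

/-- Transpose as a map `GL_n(R) → GL_n(R)` (an anti-automorphism). -/
def glTranspose (g : GL ι R) : GL ι R where
  val := (g : Matrix ι ι R)ᵀ
  inv := ((g⁻¹ : GL ι R) : Matrix ι ι R)ᵀ
  val_inv := by
    rw [← Matrix.transpose_mul, ← Units.val_mul, inv_mul_cancel, Units.val_one, Matrix.transpose_one]
  inv_val := by
    rw [← Matrix.transpose_mul, ← Units.val_mul, mul_inv_cancel, Units.val_one, Matrix.transpose_one]

/-- (Ported verbatim from the HodgeCMPerL package; no docstring in the source.) -/
@[simp] theorem coe_glTranspose (g : GL ι R) : (glTranspose g : Matrix ι ι R) = (g : Matrix ι ι R)ᵀ := rfl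

/-- (Ported verbatim from the HodgeCMPerL package; no docstring in the source.) -/
theorem glTranspose_glTranspose (g : GL ι R) : glTranspose (glTranspose g) = g :=
  Units.ext (Matrix.transpose_transpose _)

/-- (Ported verbatim from the HodgeCMPerL package; no docstring in the source.) -/
theorem glTranspose_mul (g h : GL ι R) : glTranspose (g * h) = glTranspose h * glTranspose g :=
  Units.ext (by rw [coe_glTranspose, Units.val_mul, Matrix.transpose_mul, Units.val_mul, coe_glTranspose,
    coe_glTranspose])

/-- (Ported verbatim from the HodgeCMPerL package; no docstring in the source.) -/
theorem det_glTranspose (g : GL ι R) :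
    Matrix.GeneralLinearGroup.det (glTranspose g) = Matrix.GeneralLinearGroup.det g :=
  Units.ext (by rw [Matrix.GeneralLinearGroup.val_det_apply, Matrix.GeneralLinearGroup.val_det_apply,
    coe_glTranspose, Matrix.det_transpose])

/-- (Ported verbatim from the HodgeCMPerL package; no docstring in the source.) -/
theorem glTranspose_map {S : Type*} [CommRing S] (f : R →+* S) (γ : GL ι R) :
    glTranspose (Matrix.GeneralLinearGroup.map f γ) = Matrix.GeneralLinearGroup.map f (glTranspose γ) :=
  Units.ext (by
    rw [coe_glTranspose]
    change ((γ : Matrix ι ι R).map f)ᵀ = ((γ : Matrix ι ι R)ᵀ).map f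
    rw [Matrix.transpose_map])

/-- (Ported verbatim from the HodgeCMPerL package; no docstring in the source.) -/
theorem vecMul_glTranspose (g : GL ι R) (x : ι → R) :
    x ᵥ* (glTranspose g : Matrix ι ι R) = (g : Matrix ι ι R) *ᵥ x := by
  rw [coe_glTranspose, Matrix.vecMul_transpose]

variable [TopologicalSpace R]

/-- (Ported verbatim from the HodgeCMPerL package; no docstring in the source.) -/
theorem continuous_glTranspose : Continuous (glTranspose : GL ι R → GL ι R) :=
  Units.continuous_iff.mpr ⟨Units.continuous_val.matrix_transpose,
    (Units.continuous_coe_inv.matrix_transpose).congr fun _ => rfl⟩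

variable [IsTopologicalRing R] in
/-- `det : GL_n(R) → Rˣ` is continuous for the units topologies. -/
theorem continuous_det : Continuous (Matrix.GeneralLinearGroup.det : GL ι R → Rˣ) := by
  refine Units.continuous_iff.mpr ⟨Units.continuous_val.matrix_det, ?_⟩
  have h : (fun g : GL ι R => (((Matrix.GeneralLinearGroup.det g)⁻¹ : Rˣ) : R)) =
      fun g => Matrix.det ((g⁻¹ : GL ι R) : Matrix ι ι R) := by
    funext g
    rw [← map_inv, Matrix.GeneralLinearGroup.val_det_apply]
  rw [h]
  exact Units.continuous_coe_inv.matrix_det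

end General

/-! ## § 1. Determinant bookkeeping for the Minkowski decomposition -/

section Det

variable (n : ℕ) (K : Type) [Field K] [NumberField K]

/-- `|det γ|_𝔸 = 1` for rational `γ` (product formula). -/
theorem ideleNorm_det_map (γ : GL (Fin n) K) :
    IdeleClassGroup.ideleNorm K (Matrix.GeneralLinearGroup.det
      (Matrix.GeneralLinearGroup.map (algebraMap K (AdeleRing (𝓞 K) K)) γ)) = 1 := by
  rw [Matrix.GeneralLinearGroup.map_det]
  exact ideleNorm_principal ⟨Matrix.GeneralLinearGroup.det γ, rfl⟩

variable {n} in
/-- (Ported verbatim from the HodgeCMPerL package; no docstring in the source.) -/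
theorem det_eq_one_of_mem_upperUnitriangular {R : Type*} [CommRing R] {u : GL (Fin n) R}
    (hu : u ∈ upperUnitriangular (Fin n) R) : Matrix.GeneralLinearGroup.det u = 1 := by
  obtain ⟨htri, hdiag⟩ := (mem_upperUnitriangular_iff u).mp hu
  refine Units.ext ?_
  rw [Matrix.GeneralLinearGroup.val_det_apply, Units.val_one]
  exact det_eq_one_of_blockTriangular_of_diag_eq_one htri hdiag

/-- (Ported verbatim from the HodgeCMPerL package; no docstring in the source.) -/
theorem det_glDiagonal {R : Type*} [CommRing R] (m : Fin n → Rˣ) :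
    Matrix.GeneralLinearGroup.det (glDiagonal n R m) = ∏ i, m i := by
  refine Units.ext ?_
  rw [Matrix.GeneralLinearGroup.val_det_apply, coe_glDiagonal, Matrix.det_diagonal, Units.coe_prod]

/-- `|det k|_𝔸` is bounded below by a positive constant on the maximal compact subgroup `K`. -/
theorem exists_pos_le_ideleNorm_det :
    ∃ κ : ℝ≥0, 0 < κ ∧ ∀ k ∈ standardMaximalCompactGL n K,
      κ ≤ IdeleClassGroup.ideleNorm K (Matrix.GeneralLinearGroup.det k) := by
  have hcont : Continuous fun g : GL (Fin n) (AdeleRing (𝓞 K) K) =>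
      IdeleClassGroup.ideleNorm K (Matrix.GeneralLinearGroup.det g) :=
    (continuous_ideleNorm_holds K).comp continuous_det
  obtain ⟨k₀, -, hmin⟩ := (isCompact_standardMaximalCompactGL n K).exists_isMinOn
    ⟨1, Subgroup.one_mem _⟩ hcont.continuousOn
  exact ⟨_, pos_iff_ne_zero.mpr (ideleNorm_ne_zero _), fun k hk => isMinOn_iff.mp hmin k hk⟩

/-- `|det(γ u diag(m) k)|_𝔸 = (∏ |mᵢ|_𝔸) · |det k|_𝔸`. -/
theorem ideleNorm_det_minkowski (γ : GL (Fin n) K) {u : GL (Fin n) (AdeleRing (𝓞 K) K)}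
    (hu : u ∈ upperUnitriangular (Fin n) (AdeleRing (𝓞 K) K)) (m : Fin n → (AdeleRing (𝓞 K) K)ˣ)
    (k : GL (Fin n) (AdeleRing (𝓞 K) K)) :
    IdeleClassGroup.ideleNorm K (Matrix.GeneralLinearGroup.det
      (Matrix.GeneralLinearGroup.map (algebraMap K (AdeleRing (𝓞 K) K)) γ * u *
        glDiagonal n (AdeleRing (𝓞 K) K) m * k)) =
      (∏ i, IdeleClassGroup.ideleNorm K (m i)) * IdeleClassGroup.ideleNorm K (Matrix.GeneralLinearGroup.det k) := by
  rw [map_mul, map_mul, map_mul, map_mul, map_mul, map_mul, ideleNorm_det_map,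
    det_eq_one_of_mem_upperUnitriangular hu, map_one, det_glDiagonal, map_prod, one_mul, one_mul]

end Det

/-! ## § 2. The height of the last Minkowski vector -/

section LastRow

variable (n : ℕ) (K : Type) [Field K] [NumberField K]

variable {n} in
/-- The last row of an upper unitriangular matrix is `e_n`. -/
theorem lastRow_of_mem_upperUnitriangular {R : Type*} [CommRing R] {u : GL (Fin (n + 1)) R}
    (hu : u ∈ upperUnitriangular (Fin (n + 1)) R) :
    (u : Matrix (Fin (n + 1)) (Fin (n + 1)) R).row (Fin.last n) = Pi.single (Fin.last n) 1 := by
  obtain ⟨htri, hdiag⟩ := (mem_upperUnitriangular_iff u).mp hu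
  funext j
  change (u : Matrix (Fin (n + 1)) (Fin (n + 1)) R) (Fin.last n) j = _
  by_cases hj : j = Fin.last n
  · subst hj; rw [hdiag, Pi.single_eq_same]
  · rw [Pi.single_eq_of_ne hj]
    exact htri (Fin.lt_last_iff_ne_last.mpr hj)

variable {n} in
/-- **The last Minkowski vector has height `|m_n|_𝔸`**: for `g = γ · u · diag(m) · k`,
`h((e_n γ⁻¹) · g) = h(e_n · u · diag(m) · k) = h(m_n e_n · k) = |m_n|_𝔸`. -/
theorem vecHeight_lastMinkowskiRow (γ : GL (Fin (n + 1)) K) {u : GL (Fin (n + 1)) (AdeleRing (𝓞 K) K)}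
    (hu : u ∈ upperUnitriangular (Fin (n + 1)) (AdeleRing (𝓞 K) K)) (m : Fin (n + 1) → (AdeleRing (𝓞 K) K)ˣ)
    {k : GL (Fin (n + 1)) (AdeleRing (𝓞 K) K)} (hk : k ∈ standardMaximalCompactGL (n + 1) K) :
    vecHeight K (principalVec K (Pi.single (Fin.last n) 1 ᵥ* ((γ⁻¹ : GL (Fin (n + 1)) K) :
        Matrix (Fin (n + 1)) (Fin (n + 1)) K)) ᵥ*
      ((Matrix.GeneralLinearGroup.map (algebraMap K (AdeleRing (𝓞 K) K)) γ * u *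
          glDiagonal (n + 1) (AdeleRing (𝓞 K) K) m * k : GL (Fin (n + 1)) (AdeleRing (𝓞 K) K)) :
        Matrix (Fin (n + 1)) (Fin (n + 1)) (AdeleRing (𝓞 K) K))) =
      IdeleClassGroup.ideleNorm K (m (Fin.last n)) := by
  have hξ : Pi.single (Fin.last n) (1 : K) ᵥ* ((γ⁻¹ : GL (Fin (n + 1)) K) : Matrix (Fin (n + 1)) (Fin (n + 1)) K)
      ᵥ* (γ : Matrix (Fin (n + 1)) (Fin (n + 1)) K) = Pi.single (Fin.last n) 1 := by
    rw [Matrix.vecMul_vecMul, ← Units.val_mul, inv_mul_cancel, Units.val_one, Matrix.vecMul_one]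
  rw [Units.val_mul, Units.val_mul, Units.val_mul, ← Matrix.vecMul_vecMul, ← Matrix.vecMul_vecMul,
    ← Matrix.vecMul_vecMul, principalVec_vecMul_map, hξ, principalVec_single, map_one,
    Matrix.single_one_vecMul, lastRow_of_mem_upperUnitriangular hu, coe_glDiagonal,
    Matrix.single_vecMul_diagonal, one_mul, vecHeight_vecMul_of_mem_standardMaximalCompactGL hk,
    vecHeight_single]

end LastRow

/-! ## § 3. A compact box of positive real diagonal matrices -/

section Box

variable (n : ℕ) (K : Type) [Field K] [NumberField K]

/-- Clamping real parameters from below at `lo > 0` into `(ℝ_{>0})ⁿ` (continuous). -/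
def clamp (lo : ℝ≥0) (hlo : lo ≠ 0) (s : Fin n → ℝ≥0) : Fin n → ℝ≥0ˣ :=
  fun i => Units.mk0 (max (s i) lo) (ne_of_gt (lt_max_of_lt_right (pos_iff_ne_zero.mpr hlo)))

/-- (Ported verbatim from the HodgeCMPerL package; no docstring in the source.) -/
theorem continuous_clamp (lo : ℝ≥0) (hlo : lo ≠ 0) : Continuous (clamp n lo hlo) := by
  refine continuous_pi fun i => Units.continuous_iff.mpr ⟨?_, ?_⟩
  · exact (continuous_apply i).max continuous_const
  · change Continuous fun s : Fin n → ℝ≥0 => ((max (s i) lo)⁻¹ : ℝ≥0)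
    exact ((continuous_apply i).max continuous_const).inv₀ fun s =>
      ne_of_gt (lt_max_of_lt_right (pos_iff_ne_zero.mpr hlo))

/-- (Ported verbatim from the HodgeCMPerL package; no docstring in the source.) -/
theorem clamp_eq_self (lo : ℝ≥0) (hlo : lo ≠ 0) (a : Fin n → ℝ≥0ˣ) (ha : ∀ i, lo ≤ (a i : ℝ≥0)) :
    clamp n lo hlo (fun i => (a i : ℝ≥0)) = a := by
  funext i
  exact Units.ext (max_eq_left (ha i))

/-- **The box** `{diag(z(a)) : lo ≤ aᵢ ≤ hi}` of positive real diagonal matrices is contained in a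
compact subset of `GL_n(𝔸_K)`. -/
theorem exists_isCompact_posRealDiagonal_box (lo hi : ℝ≥0) (hlo : lo ≠ 0) :
    ∃ Z : Set (GL (Fin n) (AdeleRing (𝓞 K) K)), IsCompact Z ∧
      ∀ a : Fin n → ℝ≥0ˣ, (∀ i, lo ≤ (a i : ℝ≥0) ∧ (a i : ℝ≥0) ≤ hi) → posRealDiagonal n K a ∈ Z := by
  have hcontD : Continuous (posRealDiagonal n K) :=
    (continuous_glDiagonal (AdeleRing (𝓞 K) K)).comp
      (continuous_pi fun i => (continuous_posRealIdele K).comp (continuous_apply i))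
  refine ⟨(fun s => posRealDiagonal n K (clamp n lo hlo s)) '' Set.pi Set.univ (fun _ => Set.Icc lo hi),
    (isCompact_univ_pi fun _ => isCompact_Icc).image (hcontD.comp (continuous_clamp n lo hlo)),
    fun a ha => ⟨fun i => (a i : ℝ≥0), fun i _ => ha i, by
      dsimp only
      rw [clamp_eq_self n lo hlo a fun i => (ha i).1]⟩⟩

end Box

/-! ## § 4. Mahler's criterion -/

section Mahler

variable (n : ℕ) (K : Type) [Field K] [NumberField K]


-- port_pkg: scope closed for this part
end Mahler
end HodgeCM.PerL34.Mahler
end
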